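import Literature.MathematicalPhysics.QuantumFieldTheory.ConformalBootstrap3D.PointKernelK34Data

/-!
# K34 certificate, kernel block file M2: (M) rows `21 ≤ j < 31` of `mrows`, in 10 row groups

`decide` by kernel reduction (no `native_decide`, no extra axioms) of the block checker of
`PointKernel` on the literal data of `PointKernelK34Data`; soundness is `PCert.mBlockOK_sound`.
Estimated kernel time 181 s (10 theorems).
-/

set_option maxRecDepth 100000
set_option maxHeartbeats 0

namespace Literature.MathematicalPhysics.QuantumFieldTheory.ConformalBootstrap3D.PointKernelK34

open Literature.MathematicalPhysics.QuantumFieldTheory.ConformalBootstrap3D.PointKernel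

/-- (M) rows `[21, 22)` pass the kernel evaluator. [folklore] -/
theorem mBlock_21 : cert.mBlockOK mrows 21 22 = true := by
  decide +kernel

/-- (M) rows `[22, 23)` pass the kernel evaluator. [folklore] -/
theorem mBlock_22 : cert.mBlockOK mrows 22 23 = true := by
  decide +kernel

/-- (M) rows `[23, 24)` pass the kernel evaluator. [folklore] -/
theorem mBlock_23 : cert.mBlockOK mrows 23 24 = true := by
  decide +kernel

/-- (M) rows `[24, 25)` pass the kernel evaluator. [folklore] -/
theorem mBlock_24 : cert.mBlockOK mrows 24 25 = true := by
  decide +kernel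

/-- (M) rows `[25, 26)` pass the kernel evaluator. [folklore] -/
theorem mBlock_25 : cert.mBlockOK mrows 25 26 = true := by
  decide +kernel

/-- (M) rows `[26, 27)` pass the kernel evaluator. [folklore] -/
theorem mBlock_26 : cert.mBlockOK mrows 26 27 = true := by
  decide +kernel

/-- (M) rows `[27, 28)` pass the kernel evaluator. [folklore] -/
theorem mBlock_27 : cert.mBlockOK mrows 27 28 = true := by
  decide +kernel

/-- (M) rows `[28, 29)` pass the kernel evaluator. [folklore] -/
theorem mBlock_28 : cert.mBlockOK mrows 28 29 = true := by
  decide +kernel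

/-- (M) rows `[29, 30)` pass the kernel evaluator. [folklore] -/
theorem mBlock_29 : cert.mBlockOK mrows 29 30 = true := by
  decide +kernel

/-- (M) rows `[30, 31)` pass the kernel evaluator. [folklore] -/
theorem mBlock_30 : cert.mBlockOK mrows 30 31 = true := by
  decide +kernel

end Literature.MathematicalPhysics.QuantumFieldTheory.ConformalBootstrap3D.PointKernelK34
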